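import Literature.NumberTheory.Automorphic.IntegratedOperatorFixedVectors   -- ★ p825741∕p825909 `apply_eq_zero_of_forall_comp_eq_of_forall_fixed_eq_zero`, right-invariant test functions
import Literature.NumberTheory.Automorphic.AutomorphicSpectrum               -- ★ `ClosedSubrep.fixedVectors`
import Mathlib.Analysis.InnerProductSpace.l2Space
import HarnessLib

/-!
# The `K`-fixed block of a closed invariant subspace: operators absorbing `K` on the right live on it, and their diagonal
# series along Hilbert bases may be read on the block (Borel–Jacquet §4.6; Gelbart (10.12)–(10.14))

Topic `NumberTheory/Automorphic`; THEOREMS ONLY (no definition, no instance, no notation, no named fact, no `sorry`).  Cell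
`hodgecm-mathlib`, floor 0, ROAD «TF» of the P3 desk, floor-1 preparation H1 «K′-BLOCK» for the residual letter `ArchFinTraceSplit`
(the ⊗̂-free road to «`tr π′(f_∞ ⊗ Λ) = Θ_{π′_∞}(f_∞) · tr π′_f(Λ)`»: the trace of `R(a) ∘ R(Λ)`, `Λ` bi-`K′`-invariant, on a closed
irreducible `π′ ⊂ L²` IS its trace on the `K′`-fixed block `π′^{K′}`, a closed `G_∞ × ℋ(G_f, K′)`-invariant subspace).

For a unitary representation `π` of a group `G` on a complex Hilbert space `H`, a subgroup `K ≤ G`, a closed invariant subspace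
`W ≤ H` (★ `ClosedSubrep`) with its `K`-fixed block `W^K` (★ `ClosedSubrep.fixedVectors`), and a bounded operator `T` with
`T ∘ π(k) = T` for all `k ∈ K` (e.g. `T = A ∘ π(Λ)` for a right-`K`-invariant test function `Λ`, ★ `IntegratedOperatorFixedVectors`):
* `completeSpace_fixedVectors` — `W^K` is complete (closed: ★ `ClosedSubrep.isClosed_fixedVectors`, re-proved privately here);
* `apply_mem_fixedVectors_of_forall_comp_eq` — an operator `S` with `π(k) ∘ S = S` (`k ∈ K`) and `S(W) ⊆ W` maps `W` into `W^K`;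
* **`apply_eq_zero_of_forall_comp_eq_of_orthogonal_fixedVectors`** — `T` KILLS the part of `W` orthogonal to `W^K`: `w ∈ W`, `w ⟂ W^K`
  ⇒ `T w = 0` (★ `apply_eq_zero_of_forall_comp_eq_of_forall_fixed_eq_zero` applied to `π|_K` on the closed `K`-invariant subspace
  `W ⊓ (W^K)ᗮ`, which has no non-zero `K`-fixed vector);
* **`hasSum_inner_apply_of_orthogonal_eq_zero`** (generic Hilbert-space bookkeeping) — if `T` kills `W ⊓ Vᗮ` for a closed `V ≤ W` and
  the diagonal series `Σ_k ⟪e_k, T e_k⟫` has the sum `s` along EVERY Hilbert basis of `W`, then it has the sum `s` along every Hilbert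
  basis of `V` (assemble a basis of `V` and one of `W ⊓ Vᗮ` to a basis of `W`, Mathlib `HilbertBasis.mkOfOrthogonalEqBot`; the
  `W ⊓ Vᗮ` terms vanish);
* **`hasSum_inner_apply_hilbertBasis_fixedVectors`** — THE BLOCK REDUCTION: under `T ∘ π(k) = T` (`k ∈ K`), a diagonal series of `T`
  with basis-free sum `s` on `W` has the sum `s` along every Hilbert basis of `W^K`; and its integrated-operator form
  `hasSum_inner_comp_integratedOperator_hilbertBasis_fixedVectors` for `T = A ∘ π(Λ)`, `Λ ∈ C_c(G)` right-`K`-invariant, `η` right-invariant.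
This is the operator-level half of «`tr π(f) = tr (π(f)|π^{K})` for `f` bi-`K`-invariant» [BorelJacquet1979 §4.6; Gelbart1975 (10.12)–(10.14);
DeitmarEchterhoff2014 Lemma 9.2.7]; the other half (the trace on an isotypic block, Schur) is the road's brick H2.

EDITION 2 (append-only): `hasSum_inner_apply_hilbertBasis_of_mem_iff_fixed` — the block reduction read on ANY closed subspace `V ≤ H` whose carrier IS
the `K`-fixed block of `W` (`x ∈ V ↔ x ∈ W ∧ ∀ k ∈ K, π k x = x`), e.g. the closed span `⨆ᵢ range Uᵢ` of an isotypic decomposition (★ `HilbertRepIsotypicBlockTrace`):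
the bridge J2 needs between H1 (bases of `W.fixedVectors K`, a subspace of `↥W`) and H2 (bases of a block given as a subspace of `H`).

## References
* A. Borel, H. Jacquet, *Automorphic forms and automorphic representations*, Corvallis 1979, Part 1, §4.6 [BorelJacquet1979].
* S. Gelbart, *Automorphic forms on adele groups* (1975), (10.12)–(10.14) [Gelbart1975].
* A. Deitmar, S. Echterhoff, *Principles of harmonic analysis*, 2nd ed. (2014), Lemma 9.2.7 [DeitmarEchterhoff2014].
* M. Reed, B. Simon, *Methods of Modern Mathematical Physics I* (1972), Thm. II.6, Thm. VI.24 [ReedSimon1972].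
-/

noncomputable section

open scoped InnerProductSpace
open MeasureTheory Filter Topology CompactlySupported Submodule

universe u

/-! ## §1 Generic Hilbert-space bookkeeping: diagonal series read on a closed subspace off which the operator vanishes -/

namespace Literature.NumberTheory.Automorphic

section Hilbert

variable {𝕜 : Type*} [RCLike 𝕜] {E : Type u} [NormedAddCommGroup E] [InnerProductSpace 𝕜 E] [CompleteSpace E]

omit [CompleteSpace E] in
/-- **Diagonal series on a sub-block.**  Let `W ≤ E` be a closed subspace of a Hilbert space, `V ≤ W` closed, and `T : E → E` bounded with
`T w = 0` for every `w ∈ W` orthogonal to `V`.  If `Σ_k ⟪e_k, T e_k⟫ = s` along EVERY Hilbert basis `(e_k)` of `W`, then `Σ_j ⟪v_j, T v_j⟫ = s`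
along every Hilbert basis `(v_j)` of `V`: a Hilbert basis of `V` and one of `W ⊓ Vᗮ` assemble to a Hilbert basis of `W` (Mathlib
`HilbertBasis.mkOfOrthogonalEqBot`), along which the `W ⊓ Vᗮ` terms vanish. [cite: ReedSimon1972, Thm. II.6 and Thm. VI.24] -/
theorem hasSum_inner_apply_of_orthogonal_eq_zero {W : Submodule 𝕜 E} [CompleteSpace W] (V : Submodule 𝕜 W) (hV : IsClosed (V : Set W))
    (T : E →L[𝕜] E) (hT : ∀ w : W, (∀ v ∈ V, ⟪((v : W) : E), (w : E)⟫_𝕜 = 0) → T (w : E) = 0) {s : 𝕜}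
    (h : ∀ (κ : Type u) (b : HilbertBasis κ 𝕜 W), HasSum (fun k => ⟪((b k : W) : E), T ((b k : W) : E)⟫_𝕜) s)
    {κ' : Type u} (bV : HilbertBasis κ' 𝕜 V) :
    HasSum (fun j => ⟪(((bV j : V) : W) : E), T (((bV j : V) : W) : E)⟫_𝕜) s := by
  classical
  haveI : CompleteSpace V := hV.completeSpace_coe
  -- a Hilbert basis of the complement `Vᗮ` (inside `W`)
  obtain ⟨w, bC, hbC⟩ := exists_hilbertBasis 𝕜 (Vᗮ : Submodule 𝕜 W)
  -- the assembled family
  let f : κ' ⊕ w → W := Sum.elim (fun j => ((bV j : V) : W)) fun c => ((bC c : (Vᗮ : Submodule 𝕜 W)) : W)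
  have hf_inl : ∀ j, f (Sum.inl j) = ((bV j : V) : W) := fun _ => rfl
  have hf_inr : ∀ c, f (Sum.inr c) = ((bC c : (Vᗮ : Submodule 𝕜 W)) : W) := fun _ => rfl
  have hon : Orthonormal 𝕜 f := by
    rw [orthonormal_iff_ite]
    rintro (j | c) (j' | c')
    · rw [hf_inl, hf_inl, ← Submodule.coe_inner]
      simpa using (orthonormal_iff_ite.1 bV.orthonormal j j')
    · rw [hf_inl, hf_inr, if_neg (by simp)]
      exact Submodule.inner_right_of_mem_orthogonal (bV j).2 (bC c').2
    · rw [hf_inr, hf_inl, if_neg (by simp)]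
      exact Submodule.inner_left_of_mem_orthogonal (bV j').2 (bC c).2
    · rw [hf_inr, hf_inr, ← Submodule.coe_inner]
      simpa using (orthonormal_iff_ite.1 bC.orthonormal c c')
  -- separation: a vector of `W` orthogonal to every `f i` vanishes
  have hsep : ∀ x : W, (∀ i, ⟪f i, x⟫_𝕜 = 0) → x = 0 := by
    intro x hx
    -- `x ⟂ V`: all coefficients of the projection of `x` to `V` vanish
    have hPx : V.orthogonalProjectionOnto x = 0 := by
      have hcoef : ∀ j, ⟪bV j, V.orthogonalProjectionOnto x⟫_𝕜 = 0 := fun j => by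
        rw [Submodule.inner_orthogonalProjectionOnto_eq_of_mem_left]
        exact hx (Sum.inl j)
      have : bV.repr (V.orthogonalProjectionOnto x) = 0 := by
        ext j
        rw [HilbertBasis.repr_apply_apply, hcoef]
        rfl
      exact (LinearIsometryEquiv.map_eq_zero_iff _).1 this
    have hxC : x ∈ Vᗮ := (Submodule.orthogonalProjectionOnto_eq_zero_iff).1 hPx
    -- and `x ⟂ Vᗮ`
    have hcoef' : ∀ c, ⟪bC c, (⟨x, hxC⟩ : (Vᗮ : Submodule 𝕜 W))⟫_𝕜 = 0 := fun c => by
      rw [Submodule.coe_inner]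
      exact hx (Sum.inr c)
    have hx0 : (⟨x, hxC⟩ : (Vᗮ : Submodule 𝕜 W)) = 0 := by
      have : bC.repr ⟨x, hxC⟩ = 0 := by
        ext c
        rw [HilbertBasis.repr_apply_apply, hcoef']
        rfl
      exact (LinearIsometryEquiv.map_eq_zero_iff _).1 this
    exact congrArg Subtype.val hx0
  have hbot : (span 𝕜 (Set.range f))ᗮ = ⊥ := by
    rw [Submodule.eq_bot_iff]
    intro x hx
    exact hsep x fun i => (Submodule.mem_orthogonal _ x).1 hx (f i) (Submodule.subset_span ⟨i, rfl⟩)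
  let b : HilbertBasis (κ' ⊕ w) 𝕜 W := HilbertBasis.mkOfOrthogonalEqBot hon hbot
  have hb : ∀ i, b i = f i := fun i => congrFun (HilbertBasis.coe_mkOfOrthogonalEqBot hon hbot) i
  -- the series along `b`; its `Vᗮ` terms vanish
  have hsum := h (κ' ⊕ w) b
  have hzero : ∀ c, T ((f (Sum.inr c) : W) : E) = 0 := fun c => by
    rw [hf_inr]
    exact hT _ fun v hv => by
      rw [← Submodule.coe_inner]
      exact Submodule.inner_right_of_mem_orthogonal hv (bC c).2
  have hsupp : Function.support (fun k => ⟪((b k : W) : E), T ((b k : W) : E)⟫_𝕜) ⊆ Set.range (Sum.inl : κ' → κ' ⊕ w) := by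
    intro k hk
    rw [Function.mem_support] at hk
    rcases k with j | c
    · exact ⟨j, rfl⟩
    · exfalso
      apply hk
      show ⟪((b (Sum.inr c) : W) : E), T ((b (Sum.inr c) : W) : E)⟫_𝕜 = 0
      rw [hb, hzero c, inner_zero_right]
  have h1 := (hasSum_subtype_iff_of_support_subset hsupp).2 hsum
  have h2 := ((Equiv.ofInjective (Sum.inl : κ' → κ' ⊕ w) Sum.inl_injective).hasSum_iff
    (f := (fun k => ⟪((b k : W) : E), T ((b k : W) : E)⟫_𝕜) ∘ ((↑) : Set.range (Sum.inl : κ' → κ' ⊕ w) → κ' ⊕ w))).2 h1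
  have hfun : ((fun k => ⟪((b k : W) : E), T ((b k : W) : E)⟫_𝕜) ∘ ((↑) : Set.range (Sum.inl : κ' → κ' ⊕ w) → κ' ⊕ w)) ∘
      ⇑(Equiv.ofInjective (Sum.inl : κ' → κ' ⊕ w) Sum.inl_injective) =
      fun j => ⟪(((bV j : V) : W) : E), T (((bV j : V) : W) : E)⟫_𝕜 := by
    funext j
    show ⟪((b (Sum.inl j) : W) : E), T ((b (Sum.inl j) : W) : E)⟫_𝕜 = _
    rw [hb, hf_inl]
  rw [hfun] at h2
  exact h2

end Hilbert

end Literature.NumberTheory.Automorphic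

/-! ## §2 The `K`-fixed block of a closed invariant subspace of a unitary representation -/

namespace ContRepresentation

open Literature.NumberTheory.Automorphic

variable {G : Type*} [Group G] [TopologicalSpace G] [MeasurableSpace G] [OpensMeasurableSpace G]
  {H : Type u} [NormedAddCommGroup H] [InnerProductSpace ℂ H] [CompleteSpace H] {π : ContRepresentation ℂ G H}

namespace ClosedSubrep

omit [TopologicalSpace G] [MeasurableSpace G] [OpensMeasurableSpace G] [CompleteSpace H] in
/-- The `K`-fixed block `W^K` is closed in `W` (an intersection of equalisers of the continuous `π(k)|_W`); a local copy of ★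
`ContRepresentation.ClosedSubrep.isClosed_fixedVectors` of `DiscreteAutomorphicRepNormalFixedVectors` (not imported: that module carries the
`U(H)` cohomological-forms stack, this file is generic). [cite: BorelJacquet1979, §4.6] -/
private theorem isClosed_fixedVectors_block (W : ClosedSubrep π) (K : Subgroup G) : IsClosed (W.fixedVectors K : Set W.toSubmodule) := by
  have hset : (W.fixedVectors K : Set W.toSubmodule) = ⋂ k ∈ K, {f : W.toSubmodule | W.toContRep k f = f} := by
    ext f
    simp only [SetLike.mem_coe, mem_fixedVectors, Set.mem_iInter, Set.mem_setOf_eq]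
  rw [hset]
  exact isClosed_biInter fun k _ => isClosed_eq (W.toContRep k).continuous continuous_id

omit [TopologicalSpace G] [MeasurableSpace G] [OpensMeasurableSpace G] in
/-- `W^K` is complete. [cite: BorelJacquet1979, §4.6] -/
theorem completeSpace_fixedVectors (W : ClosedSubrep π) (K : Subgroup G) : CompleteSpace (W.fixedVectors K) :=
  haveI : CompleteSpace W.toSubmodule := W.isClosed'.completeSpace_coe
  (W.isClosed_fixedVectors_block K).completeSpace_coe

omit [TopologicalSpace G] [MeasurableSpace G] [OpensMeasurableSpace G] [CompleteSpace H] in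
/-- Membership in `W^K` read in `H`: `⟨u, hu⟩ ∈ W^K ↔ ∀ k ∈ K, π k u = u`. [cite: BorelJacquet1979, §4.6] -/
theorem mk_mem_fixedVectors_iff (W : ClosedSubrep π) (K : Subgroup G) {u : H} (hu : u ∈ W) :
    (⟨u, hu⟩ : W.toSubmodule) ∈ W.fixedVectors K ↔ ∀ k ∈ K, π k u = u := by
  rw [mem_fixedVectors]
  refine forall₂_congr fun k _ => ?_
  rw [Subtype.ext_iff, coe_toContRep_apply]

end ClosedSubrep

omit [TopologicalSpace G] [MeasurableSpace G] [OpensMeasurableSpace G] [CompleteSpace H] in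
/-- **An operator absorbed by `K` on the LEFT and preserving `W` maps `W` into the block `W^K`** (e.g. `S = π(Λ)` for a left-`K`-invariant
`Λ`, ★ `apply_comp_integratedOperator_eq_self_of_forall_mul_eq` + ★ `integratedOperator_apply_mem`; or `S = π(g₁)` for `g₁` commuting with `K`).
[cite: BorelJacquet1979, §4.6] -/
theorem apply_mem_fixedVectors_of_forall_comp_eq (K : Subgroup G) (W : ClosedSubrep π) (S : H →L[ℂ] H) (hS : ∀ k ∈ K, π k ∘L S = S)
    {w : H} (hSw : S w ∈ W) : (⟨S w, hSw⟩ : W.toSubmodule) ∈ W.fixedVectors K := by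
  rw [ClosedSubrep.mk_mem_fixedVectors_iff]
  intro k hk
  rw [← ContinuousLinearMap.comp_apply, hS k hk]

omit [TopologicalSpace G] [MeasurableSpace G] [OpensMeasurableSpace G] in
/-- **An operator absorbing `K` on the RIGHT kills the part of `W` orthogonal to the block `W^K`**: if `T ∘ π(k) = T` for all `k ∈ K`, `w ∈ W`
and `⟪u, w⟫ = 0` for every `K`-fixed `u ∈ W`, then `T w = 0`.  Proof: `W′ := W ⊓ (W^K)ᗮ` is a closed `K`-invariant subspace (unitarity) without
non-zero `K`-fixed vectors, so ★ `apply_eq_zero_of_forall_comp_eq_of_forall_fixed_eq_zero` (for `π|_K`) applies. [cite: Dixmier1977, §13.1.5]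
[cite: BorelJacquet1979, §4.6] -/
theorem apply_eq_zero_of_forall_comp_eq_of_orthogonal_fixedVectors (hu : π.IsUnitary) (K : Subgroup G) (W : ClosedSubrep π)
    (T : H →L[ℂ] H) (hT : ∀ k ∈ K, T ∘L π k = T) {w : H} (hw : w ∈ W)
    (hperp : ∀ u ∈ W, (∀ k ∈ K, π k u = u) → ⟪u, w⟫_ℂ = 0) : T w = 0 := by
  -- the closed subspace `N` of vectors orthogonal to the `K`-fixed vectors of `W`
  let N : Submodule ℂ H := ⨅ u : {u : H // u ∈ W ∧ ∀ k ∈ K, π k u = u}, LinearMap.ker ((innerSL ℂ (u : H)).toLinearMap)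
  have hN : ∀ v, v ∈ N ↔ ∀ u ∈ W, (∀ k ∈ K, π k u = u) → ⟪u, v⟫_ℂ = 0 := fun v => by
    simp only [N, Submodule.mem_iInf, LinearMap.mem_ker, ContinuousLinearMap.coe_coe, Subtype.forall, and_imp]
    exact forall₃_congr fun u _ _ => by rw [innerSL_apply_apply]
  have hNclosed : IsClosed (N : Set H) := by
    have : (N : Set H) = ⋂ u : {u : H // u ∈ W ∧ ∀ k ∈ K, π k u = u}, (LinearMap.ker ((innerSL ℂ (u : H)).toLinearMap) : Set H) := by
      simp only [N, Submodule.coe_iInf]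
    rw [this]
    exact isClosed_iInter fun u => ContinuousLinearMap.isClosed_ker _
  -- `π|_K` and the closed `K`-invariant subspace `W ⊓ N`
  let πK : ContRepresentation ℂ K H := π.restrict K.subtype
  have hπK : ∀ k : K, πK k = π (k : G) := fun _ => rfl
  let W' : ClosedSubrep πK :=
    { toSubmodule := W.toSubmodule ⊓ N
      apply_mem_toSubmodule := fun k v hv => by
        change π (k : G) v ∈ W.toSubmodule ⊓ N
        refine ⟨W.apply_mem (k : G) hv.1, ?_⟩
        · show π (k : G) v ∈ N
          rw [hN]
          intro u huW hufix
          have hk' : ((k : G)⁻¹) ∈ K := K.inv_mem k.2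
          have hkey : ⟪u, π (k : G) v⟫_ℂ = ⟪π ((k : G)⁻¹) u, v⟫_ℂ := by
            rw [← hu.inner_map_map (k : G) (π ((k : G)⁻¹) u) v, ← mul_apply_eq_comp (π (k : G)) (π ((k : G)⁻¹)) u, ← map_mul π,
              mul_inv_cancel, map_one, one_apply_eq_self]
          rw [hkey, hufix _ hk']
          exact (hN v).1 hv.2 u huW hufix
      isClosed' := W.isClosed'.inter hNclosed }
  have hW' : ∀ v ∈ W', (∀ k ∈ (⊤ : Subgroup K), πK k v = v) → v = 0 := by
    intro v hv hfix
    have hv' : v ∈ W.toSubmodule ⊓ N := hv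
    have hvfix : ∀ k ∈ K, π k v = v := fun k hk => by simpa [hπK] using hfix ⟨k, hk⟩ (Subgroup.mem_top _)
    have h0 : ⟪v, v⟫_ℂ = 0 := (hN v).1 hv'.2 v hv'.1 hvfix
    exact inner_self_eq_zero.1 h0
  have hT' : ∀ k ∈ (⊤ : Subgroup K), T ∘L πK k = T := fun k _ => by rw [hπK]; exact hT k k.2
  have hw' : w ∈ W' := show w ∈ W.toSubmodule ⊓ N from ⟨hw, (hN w).2 hperp⟩
  exact apply_eq_zero_of_forall_comp_eq_of_forall_fixed_eq_zero (hu.restrict K.subtype) ⊤ W' hW' T hT' hw'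

omit [TopologicalSpace G] [MeasurableSpace G] [OpensMeasurableSpace G] in
/-- **THE BLOCK REDUCTION.**  `π` unitary, `W` closed invariant, `K ≤ G`, `T ∘ π(k) = T` for `k ∈ K`: if the diagonal series `Σ_k ⟪e_k, T e_k⟫` has the sum `s`
along EVERY Hilbert basis of `W`, it has the sum `s` along every Hilbert basis of the `K`-fixed block `W^K` («`tr T|_W = tr T|_{W^K}`»).
[cite: BorelJacquet1979, §4.6] [cite: Gelbart1975, (10.12)–(10.14)] [cite: ReedSimon1972, Thm. VI.24] -/
theorem hasSum_inner_apply_hilbertBasis_fixedVectors (hu : π.IsUnitary) (K : Subgroup G) (W : ClosedSubrep π) (T : H →L[ℂ] H)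
    (hT : ∀ k ∈ K, T ∘L π k = T) {s : ℂ}
    (h : ∀ (κ : Type u) (b : HilbertBasis κ ℂ W.toSubmodule), HasSum (fun k => ⟪((b k : W.toSubmodule) : H), T ((b k : W.toSubmodule) : H)⟫_ℂ) s)
    {κ' : Type u} (bV : HilbertBasis κ' ℂ (W.fixedVectors K)) :
    HasSum (fun j => ⟪(((bV j : W.fixedVectors K) : W.toSubmodule) : H), T (((bV j : W.fixedVectors K) : W.toSubmodule) : H)⟫_ℂ) s := by
  haveI : CompleteSpace W.toSubmodule := W.isClosed'.completeSpace_coe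
  refine hasSum_inner_apply_of_orthogonal_eq_zero (W.fixedVectors K) (ClosedSubrep.isClosed_fixedVectors_block W K) T (fun w hw => ?_) h bV
  refine apply_eq_zero_of_forall_comp_eq_of_orthogonal_fixedVectors hu K W T hT w.2 fun u huW hufix => ?_
  have h1 := hw ⟨u, huW⟩ ((W.mk_mem_fixedVectors_iff K huW).2 hufix)
  exact h1

/-- **Integrated-operator form**: for a right-invariant `η`, `Λ ∈ C_c(G)` RIGHT `K`-invariant and any bounded `A`, the diagonal series of `A ∘ π(Λ)` with basis-free
sum `s` on `W` has the sum `s` along every Hilbert basis of `W^K` (★ `integratedOperator_comp_apply_eq_self_of_forall_mul_eq`: `π(Λ) ∘ π(k) = π(Λ)`).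
This is the operator half of «`tr π(a ⊗ Λ) = tr (π(a ⊗ Λ)|π^{K})`» for `Λ ∈ ℋ(G, K)`. [cite: BorelJacquet1979, §4.6] [cite: Gelbart1975, (10.12)–(10.14)]
[cite: DeitmarEchterhoff2014, Lemma 9.2.7] -/
theorem hasSum_inner_comp_integratedOperator_hilbertBasis_fixedVectors (hu : π.IsUnitary) (hc : π.IsStronglyContinuous)
    (η : Measure G) [IsFiniteMeasureOnCompacts η] [η.IsMulRightInvariant] [MeasurableMul G]
    (K : Subgroup G) (W : ClosedSubrep π) (A : H →L[ℂ] H) (Λ : C_c(G, ℂ)) (hΛ : ∀ k ∈ K, ∀ x, Λ (x * k) = Λ x) {s : ℂ}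
    (h : ∀ (κ : Type u) (b : HilbertBasis κ ℂ W.toSubmodule),
      HasSum (fun k => ⟪((b k : W.toSubmodule) : H), (A ∘L π.integratedOperator hu hc η Λ) ((b k : W.toSubmodule) : H)⟫_ℂ) s)
    {κ' : Type u} (bV : HilbertBasis κ' ℂ (W.fixedVectors K)) :
    HasSum (fun j => ⟪(((bV j : W.fixedVectors K) : W.toSubmodule) : H),
      (A ∘L π.integratedOperator hu hc η Λ) (((bV j : W.fixedVectors K) : W.toSubmodule) : H)⟫_ℂ) s :=
  hasSum_inner_apply_hilbertBasis_fixedVectors hu K W _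
    (fun k hk => by rw [ContinuousLinearMap.comp_assoc, integratedOperator_comp_apply_eq_self_of_forall_mul_eq hu hc η K Λ hΛ hk]) h bV

/-! ## §3 (ED. 2) The block reduction on a subspace of `H` whose carrier is the fixed block -/

omit [TopologicalSpace G] [MeasurableSpace G] [OpensMeasurableSpace G] in
/-- **THE BLOCK REDUCTION, read on any closed `V ≤ H` with `V = {x ∈ W | K·x = x}`** (ED. 2; the bridge to ★ `HilbertRepIsotypicBlockTrace`, whose block is the closed
subspace `⨆ᵢ range Uᵢ` of `H`): `π` unitary, `T ∘ π(k) = T` (`k ∈ K`), the diagonal series of `T` has the sum `s` along every Hilbert basis of `W` ⇒ it has the sum `s`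
along every Hilbert basis of `V` (transport a basis of `V` to one of `W.fixedVectors K` along the tautological isometry, Mathlib `HilbertBasis.mkOfOrthogonalEqBot`).
[cite: BorelJacquet1979, §4.6] [cite: Gelbart1975, (10.12)–(10.14)] [cite: ReedSimon1972, Thm. VI.24] -/
theorem hasSum_inner_apply_hilbertBasis_of_mem_iff_fixed (hu : π.IsUnitary) (K : Subgroup G) (W : ClosedSubrep π) (T : H →L[ℂ] H)
    (hT : ∀ k ∈ K, T ∘L π k = T) {s : ℂ}
    (h : ∀ (κ : Type u) (b : HilbertBasis κ ℂ W.toSubmodule), HasSum (fun k => ⟪((b k : W.toSubmodule) : H), T ((b k : W.toSubmodule) : H)⟫_ℂ) s)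
    (V : Submodule ℂ H) [CompleteSpace V] (hV : ∀ x : H, x ∈ V ↔ x ∈ W ∧ ∀ k ∈ K, π k x = x)
    {κ' : Type u} (bV : HilbertBasis κ' ℂ V) :
    HasSum (fun j => ⟪((bV j : V) : H), T ((bV j : V) : H)⟫_ℂ) s := by
  classical
  haveI : CompleteSpace (W.fixedVectors K) := W.completeSpace_fixedVectors K
  -- the tautological map `V → W^K` and the transported family
  have hmemW : ∀ x : V, (x : H) ∈ W := fun x => ((hV x).1 x.2).1
  have hmemF : ∀ x : V, (⟨(x : H), hmemW x⟩ : W.toSubmodule) ∈ W.fixedVectors K := fun x =>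
    (W.mk_mem_fixedVectors_iff K (hmemW x)).2 ((hV x).1 x.2).2
  let g : κ' → W.fixedVectors K := fun j => ⟨⟨((bV j : V) : H), hmemW (bV j)⟩, hmemF (bV j)⟩
  have hg : ∀ j, (((g j : W.fixedVectors K) : W.toSubmodule) : H) = ((bV j : V) : H) := fun _ => rfl
  have hinner : ∀ x y : W.fixedVectors K, ⟪x, y⟫_ℂ = ⟪((x : W.toSubmodule) : H), ((y : W.toSubmodule) : H)⟫_ℂ := fun x y => by
    rw [Submodule.coe_inner, Submodule.coe_inner]
  have hon : Orthonormal ℂ g := by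
    rw [orthonormal_iff_ite]
    intro i j
    rw [hinner, hg, hg, ← Submodule.coe_inner]
    exact orthonormal_iff_ite.1 bV.orthonormal i j
  have hbot : (span ℂ (Set.range g))ᗮ = ⊥ := by
    rw [Submodule.eq_bot_iff]
    intro y hy
    -- pull `y` back to `V`
    have hyV : (((y : W.fixedVectors K) : W.toSubmodule) : H) ∈ V :=
      (hV _).2 ⟨((y : W.fixedVectors K) : W.toSubmodule).2, (W.mk_mem_fixedVectors_iff K ((y : W.fixedVectors K) : W.toSubmodule).2).1 (by simp)⟩
    set x : V := ⟨_, hyV⟩ with hx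
    have hcoef : ∀ j, ⟪bV j, x⟫_ℂ = 0 := fun j => by
      rw [Submodule.coe_inner]
      have h0 := (Submodule.mem_orthogonal _ y).1 hy (g j) (Submodule.subset_span ⟨j, rfl⟩)
      rw [hinner, hg] at h0
      exact h0
    have hx0 : x = 0 := by
      have : bV.repr x = 0 := by
        ext j
        rw [HilbertBasis.repr_apply_apply, hcoef]
        rfl
      exact (LinearIsometryEquiv.map_eq_zero_iff _).1 this
    have hyH : (((y : W.fixedVectors K) : W.toSubmodule) : H) = 0 := by
      have := congrArg (fun z : V => (z : H)) hx0
      simpa [hx] using this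
    exact Subtype.ext (Subtype.ext hyH)
  let b' : HilbertBasis κ' ℂ (W.fixedVectors K) := HilbertBasis.mkOfOrthogonalEqBot hon hbot
  have hb' : ∀ j, b' j = g j := fun j => congrFun (HilbertBasis.coe_mkOfOrthogonalEqBot hon hbot) j
  have h' := hasSum_inner_apply_hilbertBasis_fixedVectors hu K W T hT h b'
  have hfun : (fun j => ⟪(((b' j : W.fixedVectors K) : W.toSubmodule) : H), T (((b' j : W.fixedVectors K) : W.toSubmodule) : H)⟫_ℂ) =
      fun j => ⟪((bV j : V) : H), T ((bV j : V) : H)⟫_ℂ := by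
    funext j
    rw [hb' j, hg]
  rw [hfun] at h'
  exact h'

end ContRepresentation

end
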